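import Summits.ResolutionOfSingularities.ResolutionOfSingularities.Theorems.MarkedTransferCampaignW46PlaneProcrastinationCentre
import Literature.AlgebraicGeometry.Resolution.DivisorialPart
import Literature.AlgebraicGeometry.Hironaka2017.PermissibleLSB
import HarnessLib

/-!
# [OURS · L1 W4.6 rung (i-b)] The per-point measure along the blow-up of a REGULAR CURVE of the singular locus of a surface:
# the blow-up is an isomorphism and the measure does not change at any point
# (cell res-hironaka, LADDER-RESOLUTION rung L, D-0089; campaign s46, prover res-L1-s46-pv-1; host route MarkedTransfer,
# `--supports stmt-ResolutionOfSingularities-16155`)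

HONEST FRAMING. Nothing here is a statement of H. Hironaka's manuscript (2017-03-23, [Hironaka2017]); OURS bookkeeping over
tree theorems: a prime divisor on a regular scheme is an effective Cartier divisor (`PrimeDivisorIdeals.lean`), blowing up an
effective Cartier divisor is an isomorphism (`IsBlowup.isIso`), the stalks of the controlled transform
(`IsBlowup.stalkIdeal_controlledTransform`), the regular centre inside `Sing(J, b)` has `J ⊆ 𝓘_D^b`
(`Hironaka2017.PermissibleLSB`: `le_vanishingIdeal_pow_of_forall_le_idealOrder`, standard scheme theory), and this seat's
normal form (`normalForm_colon_eq`). AI-written; weaker than expert review. No `sorry`; axioms standard.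

## Contents

* `not_mem_sq_of_maximalIdeal_eq_span_pair` — a member of a two-element generating set of `𝔪` in a regular local ring of
  dimension two is a regular parameter; `not_mem_sq_of_isRegularLocalRing_quotient` — a prime `ρ` of a regular local ring of
  dimension `≤ 2` with regular quotient `R/(ρ)` is a regular parameter.
* `looseGermMeasure_colon_eq` — `μ` does not see an admissible division: `ν̃(R, NF((J : ρ^b)), b) = ν̃(R, NF(J), b)`.
* **`isIso_of_curveCentre`**, **`looseGermMeasure_curveStep_eq`** — for the blow-up `π` of an ambient surface along a
  permissible centre `D` whose generic point has codimension one: `π` is an isomorphism and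
  `μ(A′, E′, y′) = μ(A, E, π y′)` at EVERY point `y′`.

## References

* U. Görtz, T. Wedhorn, *Algebraic Geometry I* (2020), Thm. 11.40 (2), (13.19). [GortzWedhorn2020]
* V. Cossart, O. Piltant, J. Algebra 320 (2008), proof of Prop. 4.2. [CossartPiltant2008]
-/

noncomputable section

set_option linter.dupNamespace false -- mandated namespace of this single-conjunct summit

open CategoryTheory AlgebraicGeometry TopologicalSpace IsLocalRing

namespace Summit.ResolutionOfSingularities.ResolutionOfSingularities.Theorems

namespace CampaignW46

open Literature.AlgebraicGeometry.Resolution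
open Literature.AlgebraicGeometry.Hironaka2017.S02Preliminaries
open Scheme.IdealSheafData

universe u

/-! ## Regular parameters -/

/-- In a two-dimensional regular local ring, a member of a two-element generating set of `𝔪` is not in `𝔪²` (Nakayama:
otherwise `𝔪 = (y)`). [cite: Matsumura1987, Thm. 14.3] -/
theorem not_mem_sq_of_maximalIdeal_eq_span_pair {R : Type u} [CommRing R] [IsRegularLocalRing R]
    (hdim : ringKrullDim R = 2) {x y : R} (hm : maximalIdeal R = Ideal.span {x, y}) : x ∉ maximalIdeal R ^ 2 := by
  intro hx
  apply maximalIdeal_ne_span_singleton hdim y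
  have hyle : Ideal.span {y} ≤ maximalIdeal R := by
    rw [Ideal.span_singleton_le_iff_mem, hm]; exact Ideal.subset_span (by simp)
  refine le_antisymm ?_ hyle
  have hle : maximalIdeal R ≤ Ideal.span {y} ⊔ maximalIdeal R • maximalIdeal R := by
    conv_lhs => rw [hm]
    rw [Ideal.span_le]
    rintro z (rfl | hz)
    · apply Ideal.mem_sup_right
      rw [Ideal.smul_eq_mul, ← pow_two]
      exact hx
    · rw [Set.mem_singleton_iff] at hz
      subst hz
      exact Ideal.mem_sup_left (Ideal.mem_span_singleton_self z)
  have hfg : (maximalIdeal R).FG := IsNoetherian.noetherian _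
  have hjac : maximalIdeal R ≤ (⊥ : Ideal R).jacobson := by
    rw [IsLocalRing.jacobson_eq_maximalIdeal ⊥ bot_ne_top]
  exact Submodule.le_of_le_smul_of_le_jacobson_bot hfg hjac hle

/-- **A prime `ρ` of a regular local ring of dimension `≤ 2` with regular quotient `R/(ρ)` is a regular parameter**
(`ρ ∉ 𝔪²`): in dimension `≤ 1` the ring is a discrete valuation ring and `(ρ) = 𝔪`; in dimension two `R/(ρ)` is a regular
local ring of dimension one, its maximal ideal is principal `(t̄)`, so `𝔪 = (ρ, t)`. [cite: Matsumura1987, Thm. 14.2] -/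
theorem not_mem_sq_of_isRegularLocalRing_quotient {R : Type u} [CommRing R] [IsRegularLocalRing R]
    (hdim : ringKrullDim R ≤ 2) {ρ : R} (hρ : Prime ρ) (hreg : IsRegularLocalRing (R ⧸ Ideal.span {ρ})) :
    ρ ∉ maximalIdeal R ^ 2 := by
  haveI := isDomain_of_isRegularLocalRing R
  have hρm : ρ ∈ maximalIdeal R := by rw [mem_maximalIdeal, mem_nonunits_iff]; exact hρ.not_unit
  -- the dimension of `R` is `1` or `2`
  have hne : maximalIdeal R ≠ ⊥ := fun h => hρ.ne_zero (by
    have := hρm; rw [h, Ideal.mem_bot] at this; exact this)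
  obtain ⟨e, he⟩ := WithBot.ne_bot_iff_exists.mp (ringKrullDim_ne_bot (R := R))
  have het : e ≠ ⊤ := fun ht => ringKrullDim_ne_top (R := R) (by rw [← he, ht]; rfl)
  obtain ⟨d, rfl⟩ := ENat.ne_top_iff_exists.mp het
  have hd2 : d ≤ 2 := by
    have hA : ((d : ℕ∞) : WithBot ℕ∞) ≤ ((2 : ℕ∞) : WithBot ℕ∞) := by rw [he]; exact hdim
    exact_mod_cast (WithBot.coe_le_coe.mp hA)
  have hd0 : d ≠ 0 := by
    intro h0
    subst h0
    have hf : IsField R := by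
      haveI : Ring.KrullDimLE 0 R := Ring.krullDimLE_iff.mpr (by rw [← he]; exact le_rfl)
      exact Ring.KrullDimLE.isField_of_isDomain
    exact hne ((IsLocalRing.isField_iff_maximalIdeal_eq).mp hf)
  interval_cases d
  · exact absurd rfl hd0
  · -- dimension one: a discrete valuation ring, `(ρ) = 𝔪`
    have h1 : ringKrullDim R = 1 := by rw [← he]; rfl
    haveI := Literature.RingTheory.RegularLocalRing.isDiscreteValuationRing_of_ringKrullDim_eq_one h1
    haveI : (Ideal.span {ρ}).IsPrime := (Ideal.span_singleton_prime hρ.ne_zero).mpr hρ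
    have hmax : Ideal.span {ρ} = maximalIdeal R := by
      refine ((IsLocalRing.isMaximal_iff _).mp ?_)
      exact Ideal.IsPrime.isMaximal inferInstance (by rw [Ne, Ideal.span_singleton_eq_bot]; exact hρ.ne_zero)
    have hirr : Irreducible ρ := (IsDiscreteValuationRing.irreducible_iff_uniformizer ρ).mpr hmax.symm
    intro h2
    rw [← hmax, Ideal.span_singleton_pow, Ideal.mem_span_singleton] at h2
    obtain ⟨c, hc⟩ := h2
    apply hirr.not_isUnit
    refine isUnit_iff_exists_inv.mpr ⟨c, mul_left_cancel₀ hρ.ne_zero ?_⟩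
    rw [mul_one, ← mul_assoc, ← pow_two]
    exact hc.symm
  · -- dimension two
    have h2 : ringKrullDim R = 2 := by rw [← he]; rfl
    -- `R/(ρ)` is a regular local ring of dimension one, hence a DVR with principal maximal ideal
    haveI := hreg
    haveI : IsDomain (R ⧸ Ideal.span {ρ}) := isDomain_of_isRegularLocalRing _
    have hq1 : ringKrullDim (R ⧸ Ideal.span {ρ}) = 1 := by
      have hle := ringKrullDim_quotient_succ_le_of_nonZeroDivisor (mem_nonZeroDivisors_of_ne_zero hρ.ne_zero)
      rw [h2] at hle
      have hnf : ¬ IsField (R ⧸ Ideal.span {ρ}) := by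
        intro hf
        have hmx : (Ideal.span {ρ}).IsMaximal := Ideal.Quotient.maximal_of_isField _ hf
        exact maximalIdeal_ne_span_singleton h2 ρ ((IsLocalRing.eq_maximalIdeal hmx).symm)
      obtain ⟨e', he'⟩ := WithBot.ne_bot_iff_exists.mp (ringKrullDim_ne_bot (R := R ⧸ Ideal.span {ρ}))
      have het' : e' ≠ ⊤ := fun ht => ringKrullDim_ne_top (R := R ⧸ Ideal.span {ρ}) (by rw [← he', ht]; rfl)
      obtain ⟨d', rfl⟩ := ENat.ne_top_iff_exists.mp het'
      rw [← he'] at hle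
      have hd'1 : d' ≤ 1 := by
        have h1' : (((d' : ℕ∞) + 1 : ℕ∞) : WithBot ℕ∞) ≤ ((2 : ℕ∞) : WithBot ℕ∞) := hle
        have h1'' : (d' : ℕ∞) + 1 ≤ 1 + 1 := WithBot.coe_le_coe.mp h1'
        exact_mod_cast (ENat.add_le_add_iff_right ENat.one_ne_top).mp h1''
      have hd'0 : d' ≠ 0 := by
        intro h0; subst h0
        haveI : Ring.KrullDimLE 0 (R ⧸ Ideal.span {ρ}) := Ring.krullDimLE_iff.mpr (by rw [← he']; exact le_rfl)
        exact hnf Ring.KrullDimLE.isField_of_isDomain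
      rw [← he']
      have : d' = 1 := by omega
      rw [this]; rfl
    haveI hdvr := Literature.RingTheory.RegularLocalRing.isDiscreteValuationRing_of_ringKrullDim_eq_one hq1
    obtain ⟨tb, htb⟩ := IsDiscreteValuationRing.exists_irreducible (R ⧸ Ideal.span {ρ})
    have hmq : maximalIdeal (R ⧸ Ideal.span {ρ}) = Ideal.span {tb} :=
      (IsDiscreteValuationRing.irreducible_iff_uniformizer tb).mp htb
    obtain ⟨t, rfl⟩ := Ideal.Quotient.mk_surjective tb
    -- `𝔪 = (ρ, t)`
    have hm : maximalIdeal R = Ideal.span {ρ, t} := by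
      have hmk : (maximalIdeal R).map (Ideal.Quotient.mk (Ideal.span {ρ})) = maximalIdeal (R ⧸ Ideal.span {ρ}) :=
        IsLocalRing.map_maximalIdeal_of_surjective _ Ideal.Quotient.mk_surjective
      apply le_antisymm
      · intro z hz
        have hz' : Ideal.Quotient.mk (Ideal.span {ρ}) z ∈ Ideal.span {Ideal.Quotient.mk (Ideal.span {ρ}) t} := by
          rw [← hmq, ← hmk]; exact Ideal.mem_map_of_mem _ hz
        obtain ⟨c', hc'⟩ := Ideal.mem_span_singleton'.mp hz'
        obtain ⟨c, rfl⟩ := Ideal.Quotient.mk_surjective c'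
        have hdiff : z - c * t ∈ Ideal.span {ρ} := by
          rw [← Ideal.Quotient.eq, map_mul, hc']
        obtain ⟨a, ha⟩ := Ideal.mem_span_singleton'.mp hdiff
        rw [Ideal.mem_span_pair]
        exact ⟨a, c, by rw [ha]; ring⟩
      · rw [Ideal.span_le]
        rintro z (rfl | hz)
        · exact hρm
        · rw [Set.mem_singleton_iff] at hz; subst hz
          have : Ideal.Quotient.mk (Ideal.span {ρ}) z ∈ maximalIdeal (R ⧸ Ideal.span {ρ}) := by
            rw [hmq]; exact Ideal.mem_span_singleton_self _
          rw [← hmk] at this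
          obtain ⟨w, hw, hwz⟩ := (Ideal.mem_map_iff_of_surjective _ Ideal.Quotient.mk_surjective).mp this
          have hdiff : z - w ∈ Ideal.span {ρ} := by rw [← Ideal.Quotient.eq, hwz]
          have : z = w + (z - w) := by ring
          rw [SetLike.mem_coe, this]
          exact Ideal.add_mem _ hw ((Ideal.span_singleton_le_iff_mem _).mpr hρm hdiff)
    exact not_mem_sq_of_maximalIdeal_eq_span_pair h2 hm

/-! ## The measure does not see an admissible division -/

/-- **An admissible division does not change the measure**: for a regular-parameter prime `ρ` of the local domain `R`
with `J ⊆ (ρ^b)`, `μ(R, (J : ρ^b), b) = μ(R, J, b)` (`normalForm_colon_eq`). [folklore] -/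
theorem looseGermMeasure_colon_eq {R : Type u} [CommRing R] [IsLocalRing R] [IsDomain R] {b : ℕ} {ρ : R}
    (hρ : Prime ρ) (hρ2 : ρ ∉ maximalIdeal R ^ 2) {J : Ideal R} (hJ : J ≤ Ideal.span {ρ ^ b}) :
    looseGermMeasure R (Submodule.colon J (Ideal.span {ρ ^ b})) b = looseGermMeasure R J b := by
  rw [looseGermMeasure_eq, looseGermMeasure_eq, normalForm_colon_eq hρ hρ2 hJ]

/-! ## The blow-up of a regular curve of a surface -/

variable {p : ℕ} [Fact p.Prime] {K : Type u} [Field K] [CharP K p]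

/-- The reduced ideal of a closed irreducible `D` is the prime divisor ideal of its generic point. [folklore] -/
theorem vanishingIdeal_eq_primeDivisorIdeal {Z : Scheme.{u}} {D : Closeds Z} {η : Z} (hη : IsGenericPoint η (D : Set Z)) :
    vanishingIdeal D = primeDivisorIdeal η := by
  have hD : D = ⟨closure {η}, isClosed_closure⟩ := Closeds.ext hη.def.symm
  rw [hD]; rfl

/-- **The blow-up of an ambient scheme along a permissible centre whose generic point has codimension one is an
ISOMORPHISM**: the centre's reduced ideal is a prime divisor on a regular scheme, hence an effective Cartier divisor.
[cite: GortzWedhorn2020, Thm. 11.40 (2)] -/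
theorem isIso_of_curveCentre (A A' : AmbientDatum p K) {D : Closeds A.Z} {η : A.Z} (hη : IsGenericPoint η (D : Set A.Z))
    (hcoh : Order.coheight η = 1) {π : A'.Z ⟶ A.Z} (hπ : IsBlowup π (vanishingIdeal D)) : IsIso π := by
  haveI := ambient_isIntegral A
  haveI : IsLocallyNoetherian A.Z := ambient_isLocallyNoetherian A
  refine hπ.isIso ?_
  rw [vanishingIdeal_eq_primeDivisorIdeal hη]
  exact isEffectiveCartier_primeDivisorIdeal_of_isRegular (ambient_isRegular A) hcoh

/-- **THE CURVE-STEP LAW of the measure.** Let `π : Z′ → Z` be the blow-up of an ambient surface (`topologicalKrullDim Z ≤ 2`)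
along a centre `D` permissible for `E` whose generic point `η` has codimension one (a regular curve of `Sing(E)`), and `E′`
the transform. Then `μ(A′, E′, y′) = μ(A, E, π y′)` at every point `y′`: the stalk map is an isomorphism carrying `J_y`
to `J′_{y′}` off `D` and `(J_y : ρ^b)` to `J′_{y′}` on `D`, `ρ` a regular parameter generating `𝓘_{D,y}`, and the normal
form does not see the division. [cite: CossartPiltant2008, proof of Prop. 4.2] -/
theorem looseGermMeasure_curveStep_eq (A A' : AmbientDatum p K) (E : IdealExponent A.Z)
    (hdimZ : topologicalKrullDim A.Z ≤ 2) {D : Closeds A.Z} (hD : E.IsPermissibleCentre A.hom D) {η : A.Z}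
    (hη : IsGenericPoint η (D : Set A.Z)) (hcoh : Order.coheight η = 1) {π : A'.Z ⟶ A.Z}
    (hπ : IsBlowup π (vanishingIdeal D)) (y' : A'.Z) :
    looseGermMeasure (A'.Z.presheaf.stalk y') (stalkIdeal (E.transform π D).J y') E.b =
      looseGermMeasure (A.Z.presheaf.stalk (π y')) (stalkIdeal E.J (π y')) E.b := by
  haveI := ambient_isIntegral A
  haveI : IsLocallyNoetherian A.Z := ambient_isLocallyNoetherian A
  haveI : IsIso π := isIso_of_curveCentre A A' hη hcoh hπ
  haveI : IsRegularLocalRing (A.Z.presheaf.stalk (π y')) := ambient_isRegular A (π y')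
  set y := π y' with hy
  -- the stalk isomorphism and the transported colon
  let e : A.Z.presheaf.stalk y ≃+* A'.Z.presheaf.stalk y' := (asIso (π.stalkMap y')).commRingCatIsoToRingEquiv
  have he : e.toRingHom = (π.stalkMap y').hom := rfl
  have hJ' : stalkIdeal (E.transform π D).J y' =
      (Submodule.colon (stalkIdeal E.J y) (stalkIdeal (vanishingIdeal D) y ^ E.b : Ideal (A.Z.presheaf.stalk y))).map e := by
    show stalkIdeal (controlledTransform π (vanishingIdeal D) E.J E.b) y' = _
    rw [hπ.stalkIdeal_controlledTransform E.J E.b y', stalkIdeal_comap_eq_map_stalkMap,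
      stalkIdeal_comap_eq_map_stalkMap, ← Ideal.map_pow, ← he]
    exact (map_colon_eq_of_ringEquiv e _ _).symm
  rw [hJ', looseGermMeasure_map_ringEquiv]
  -- on or off the centre
  by_cases hyD : y ∈ (D : Set A.Z)
  · -- on the centre: `𝓘_{D,y} = (ρ)`, `ρ` a regular parameter, `J_y ⊆ (ρ^b)`
    have hsp : η ⤳ y := hη.specializes hyD
    obtain ⟨ρ, hρ, hIρ⟩ := exists_stalkIdeal_primeDivisorIdeal_eq_span
      (ambient_isRegular A).uniqueFactorizationMonoid_stalk hsp hcoh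
    rw [← vanishingIdeal_eq_primeDivisorIdeal hη] at hIρ
    -- regularity of `D` at `y`
    have hregD : Scheme.IsRegular (vanishingIdeal D).subscheme := by
      haveI := hD.smooth
      exact fun z => isRegularLocalRing_stalk_of_smooth_of_field ((vanishingIdeal D).subschemeι ≫ A.hom) z
    have hysupp : y ∈ (vanishingIdeal D).support := by
      rw [← SetLike.mem_coe, coe_support_vanishingIdeal]; exact hyD
    have hregq : IsRegularLocalRing (A.Z.presheaf.stalk y ⧸ Ideal.span {ρ}) := by
      rw [← hIρ]; exact isRegularLocalRing_stalk_quotient_stalkIdeal hregD hysupp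
    have hdimy : ringKrullDim (A.Z.presheaf.stalk y) ≤ 2 := by
      rw [ringKrullDim_stalk_eq_coheight]
      have h := coe_height_add_coheight_le_topologicalKrullDim y
      have h' : ((Order.coheight y : ℕ∞) : WithBot ℕ∞) ≤ ((Order.height y + Order.coheight y : ℕ∞) : WithBot ℕ∞) :=
        WithBot.coe_le_coe.mpr le_add_self
      exact h'.trans (h.trans hdimZ)
    have hρ2 : ρ ∉ maximalIdeal (A.Z.presheaf.stalk y) ^ 2 := not_mem_sq_of_isRegularLocalRing_quotient hdimy hρ hregq
    -- `J_y ⊆ (ρ^b)`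
    have hJle : stalkIdeal E.J y ≤ Ideal.span {ρ ^ E.b} := by
      have hglob : E.J ≤ vanishingIdeal D ^ E.b :=
        Literature.AlgebraicGeometry.Hironaka2017.le_vanishingIdeal_pow_of_forall_le_idealOrder (ambient_isRegular A)
          hregD (fun z hz => hD.subset_sing hz)
      have h1 := stalkIdeal_mono hglob y
      rw [stalkIdeal_pow, hIρ, Ideal.span_singleton_pow] at h1
      exact h1
    rw [hIρ, Ideal.span_singleton_pow]
    exact looseGermMeasure_colon_eq hρ hρ2 hJle
  · -- off the centre: `𝓘_{D,y} = 𝒪`, the colon is `J_y`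
    have hysupp : y ∉ (vanishingIdeal D).support := by
      rw [← SetLike.mem_coe, coe_support_vanishingIdeal]; exact hyD
    rw [stalkIdeal_eq_top_of_not_mem_support hysupp, Ideal.top_pow]
    congr 1
    ext z
    rw [Submodule.mem_colon]
    constructor
    · intro h; simpa using h 1 Submodule.mem_top
    · intro hz q _; rw [smul_eq_mul]; exact Ideal.mul_mem_right _ _ hz

end CampaignW46

end Summit.ResolutionOfSingularities.ResolutionOfSingularities.Theorems

end
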